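import Summits.ResolutionOfSingularities.ResolutionOfSingularities.Theorems.FrobeniusClosingPatchingRelPerfectConeCubeLevelTwoIdeals
import HarnessLib

/-!
# Crux `PatchingRelPerfect` (stmt-ResolutionOfSingularities-16161), chain w52 — the contact-migration
# member at EVERY depth `ℓ`: `(x₀x₁ + x₂² + x₃³) + 𝔪^{ℓ+2}` — level-two chart ideals

[OURS · L1 W5.2 · rung] Generalises `…ConeCubeLevelTwoIdeals` (`ℓ = 2`) to every depth `ℓ ≥ 1`.
On the vertex chart `B₃` the member is `u² · ((z) + (u)^ℓ)`, `z = F + t`; the companion is the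
lattice path of `3ℓ - 1` nodes `M_{k,m} = (z) + (t)ᵏ N^m`,
`(k, m) = (0,2), (1,0), (1,1), (1,2), (2,0), …, (ℓ-1,2), (ℓ,0)`, i.e. node `s` has
`k = (s+2)/3`, `m = (s+2)%3`.  On the chart `C_j` of the vertex blow-up node `s` becomes
`(w) · (c, w^{2k+m-1} Gᵏ) = (w) · (c, L₀ ⋯ L_s)` for the LETTER WORD `L_r = G` if `r % 3 = 1`, else
`L_r = w` (`w G w w G w w G …`).  PROVED (any commutative ring):

* `cmFlag_prod_letters` — `w^{2k+m-1} Gᵏ = L₀ ⋯ L_s` (induction on `s`);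
* `cmLetters_spec` — the letters lie in `{w, G, 1}`;
* `map_cmNode` — the image of node `s`; `map_finset_prod` — `Ideal.map` of a finite product;
* `map_chartBase_cmPi` — `Π_ℓ C_j = (w)^{3ℓ-1} · ∏_{s<3ℓ-1} (c, L₀⋯L_s)`;
* `map_chartBase_cmPi_zero` — on the `t`-chart `Π_ℓ C₀ = (w)^{3ℓ-1}`.

Nothing here is a statement of the manuscript under review.

## References

* The Stacks Project, Tags 0804, 080B. [StacksProject]
-/

-- `Summit.<Summit>.<Sub>.Theorems` with `Sub = Summit` (single-conjunct summit, D-0017)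
set_option linter.dupNamespace false

noncomputable section

open CategoryTheory CategoryTheory.Limits AlgebraicGeometry Literature.AlgebraicGeometry.Resolution
open IsLocalRing

namespace Summit.ResolutionOfSingularities.ResolutionOfSingularities.Theorems

namespace ConeRung

universe u

/-! ## Generic: the word `w G w w G w w G …` and its flag -/

section Generic

variable {R B : Type*} [CommRing R] [CommRing B]

/-- `Ideal.map` of a finite product over `range n`. [folklore] -/
theorem map_finset_prod (f : R →+* B) (g : ℕ → Ideal R) (n : ℕ) :
    (∏ s ∈ Finset.range n, g s).map f = ∏ s ∈ Finset.range n, (g s).map f := by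
  induction n with
  | zero =>
    rw [Finset.prod_range_zero, Finset.prod_range_zero, Ideal.one_eq_top, Ideal.map_top,
      Ideal.one_eq_top]
  | succ n ih => rw [Finset.prod_range_succ, Finset.prod_range_succ, Ideal.map_mul, ih]

/-- **The flag exponents follow the word**: with `k = (s+2)/3`, `m = (s+2)%3`,
`w^{2k+m-1} Gᵏ = L₀ ⋯ L_s` for `L_r = G` (`r % 3 = 1`), `L_r = w` otherwise. [folklore] -/
theorem cmFlag_prod_letters (w G : B) (s : ℕ) :
    w ^ (2 * ((s + 2) / 3) + (s + 2) % 3 - 1) * G ^ ((s + 2) / 3) =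
      ∏ r ∈ Finset.range (s + 1), (if r % 3 = 1 then G else w) := by
  induction s with
  | zero => simp
  | succ s ih =>
    rw [Finset.prod_range_succ, ← ih]
    by_cases h : (s + 1) % 3 = 1
    · rw [if_pos h]
      have hk : (s + 1 + 2) / 3 = (s + 2) / 3 + 1 := by omega
      have he : 2 * ((s + 1 + 2) / 3) + (s + 1 + 2) % 3 - 1 =
          2 * ((s + 2) / 3) + (s + 2) % 3 - 1 := by omega
      rw [he, hk, pow_succ G]
      ring
    · rw [if_neg h]
      have hk : (s + 1 + 2) / 3 = (s + 2) / 3 := by omega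
      have he : 2 * ((s + 1 + 2) / 3) + (s + 1 + 2) % 3 - 1 =
          2 * ((s + 2) / 3) + (s + 2) % 3 - 1 + 1 := by omega
      rw [he, hk, pow_succ w]
      ring

/-- The letters lie in `{w, G, 1}` (input of `…LetterTower`). [folklore] -/
theorem cmLetters_spec (w G : B) (r : ℕ) :
    (if r % 3 = 1 then G else w) = w ∨ (if r % 3 = 1 then G else w) = G ∨
      (if r % 3 = 1 then G else w) = 1 := by
  by_cases h : r % 3 = 1
  · exact Or.inr (Or.inl (if_pos h))
  · exact Or.inl (if_neg h)
  
/-- `k + m ≥ 1` along the path. [folklore] -/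
theorem cmNode_pos (s : ℕ) : 1 ≤ (s + 2) / 3 + (s + 2) % 3 := by omega

variable (ψ : R →+* B) (z u : R) (𝔫 : Ideal R) (w u' h : B)
  (hz : ψ z = w * (u' + w * h)) (hu : ψ u = w * u') (h𝔫 : 𝔫.map ψ = Ideal.span {w})

include hz hu h𝔫 in
/-- **Image of node `s`**: `ψ((z) + uᵏ 𝔫ᵐ) = (w) · (u' + w h, L₀⋯L_s)`. [cite: StacksProject, Tag 080B] -/
theorem map_cmNode (s : ℕ) :
    (Ideal.span {z} ⊔ Ideal.span {u} ^ ((s + 2) / 3) * 𝔫 ^ ((s + 2) % 3)).map ψ =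
      Ideal.span {w} * Ideal.span {u' + w * h,
        ∏ r ∈ Finset.range (s + 1), (if r % 3 = 1 then h else w)} := by
  rw [map_span_sup_pow_mul_pow_flag ψ z u 𝔫 w u' h hz hu h𝔫 _ _ (cmNode_pos s),
    cmFlag_prod_letters]

include hz hu h𝔫 in
/-- **Image of the path product** `Π_ℓ = ∏_{s<n} M_s`: `(w)ⁿ · ∏_{s<n} (c, L₀⋯L_s)`.
[cite: StacksProject, Tag 080B] -/
theorem map_cmPi (n : ℕ) :
    (∏ s ∈ Finset.range n,
        (Ideal.span {z} ⊔ Ideal.span {u} ^ ((s + 2) / 3) * 𝔫 ^ ((s + 2) % 3))).map ψ =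
      Ideal.span {w} ^ n * ∏ s ∈ Finset.range n, Ideal.span {u' + w * h,
        ∏ r ∈ Finset.range (s + 1), (if r % 3 = 1 then h else w)} := by
  rw [map_finset_prod]
  simp_rw [map_cmNode ψ z u 𝔫 w u' h hz hu h𝔫]
  rw [Finset.prod_mul_distrib, Finset.prod_const, Finset.card_range]

/-- **The `u`-chart**: if `ψ z = w (1 + w q)`, `ψ u = w`, `ψ(𝔫) = (w)` then every node maps to
`(w)` and `ψ(Π) = (w)ⁿ`. [cite: StacksProject, Tag 080B] -/
theorem map_cmPi_of_unit (ψ : R →+* B) (z u : R) (𝔫 : Ideal R) (w q : B)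
    (hz : ψ z = w * (1 + w * q)) (hu : ψ u = w) (h𝔫 : 𝔫.map ψ = Ideal.span {w}) (n : ℕ) :
    (∏ s ∈ Finset.range n,
        (Ideal.span {z} ⊔ Ideal.span {u} ^ ((s + 2) / 3) * 𝔫 ^ ((s + 2) % 3))).map ψ =
      Ideal.span {w} ^ n := by
  rw [map_finset_prod]
  have h1 : ∀ s, (Ideal.span {z} ⊔ Ideal.span {u} ^ ((s + 2) / 3) * 𝔫 ^ ((s + 2) % 3)).map ψ =
      Ideal.span {w} := fun s =>
    map_span_sup_pow_mul_pow_of_unit ψ z u 𝔫 w q hz hu h𝔫 _ _ (cmNode_pos s)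
  simp_rw [h1]
  rw [Finset.prod_const, Finset.card_range]

end Generic

/-! ## Level two on the charts of the vertex blow-up -/

section LevelTwo

variable {A : Type u} [CommRing A] (t : A) (v : Fin 3 → A) (j : Fin 4)

local notation3 "cc" => (Fin.cons t v : Fin 4 → A)
local notation3 "zC" => v 0 * v 1 + v 2 ^ 2 + t
local notation3 "N" => Ideal.span {t, v 0, v 1, v 2}
/-- the companion path `Π_n = ∏_{s<n} ((z) + (t)^{(s+2)/3} N^{(s+2)%3})` at the vertex chart -/
local notation3 "cmPi[" n "]" => ∏ s ∈ Finset.range n,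
  (Ideal.span {v 0 * v 1 + v 2 ^ 2 + t} ⊔
    Ideal.span {t} ^ ((s + 2) / 3) * Ideal.span {t, v 0, v 1, v 2} ^ ((s + 2) % 3))
local notation3 "ψ" => chartBase cc j
local notation3 "w" => chartBase cc j (cc j)
local notation3 "e'[" l "]" => chartGen cc j l
local notation3 "G" => chartGen cc j 1 * chartGen cc j 2 + chartGen cc j 3 ^ 2

/-- **The total transform of `Π_n` on the chart `C_j`**: `(w)ⁿ · ∏_{s<n} (c, L₀⋯L_s)` with
`c = u' + w G` and the word `w G w w G …`. [cite: StacksProject, Tag 080B] -/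
theorem map_chartBase_cmPi (n : ℕ) :
    (cmPi[n]).map ψ = Ideal.span {w} ^ n *
      ∏ s ∈ Finset.range n, Ideal.span {e'[0] + w * G,
        ∏ r ∈ Finset.range (s + 1), (if r % 3 = 1 then G else w)} :=
  map_cmPi ψ zC t N w e'[0] G (chartBase_zC t v j) (chartBase_t_two t v j)
    (map_chartBase_span_t_v t v j) n

/-- **On the `t`-chart everything is Cartier**: `Π_n C₀ = (w)ⁿ`. [cite: StacksProject, Tag 080B] -/
theorem map_chartBase_cmPi_zero (n : ℕ) :
    (cmPi[n]).map (chartBase cc 0) = Ideal.span {chartBase cc 0 (cc 0)} ^ n :=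
  map_cmPi_of_unit (chartBase cc 0) zC t N _ _ (chartBase_zC_zero t v)
    rfl
    (map_chartBase_span_t_v t v 0) n

end LevelTwo

end ConeRung

end Summit.ResolutionOfSingularities.ResolutionOfSingularities.Theorems

end
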